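import Mathlib.Topology.Order.IntermediateValue
import Mathlib.Topology.UnitInterval
import Mathlib.Topology.Algebra.Order.Field
import Literature.Analysis.Complex.HalfPlaneQuasiGeodesic

/-!
# Curve upgrade, part 1a: a macroscopic backtrack of a continuous function forces three crossings

Support file for the crux `HexConjecture` (stmt-CriticalPhenomena-0808, Duminil-Copin–Smirnov 2012
Conjecture 1), line `root-locality-replaces-loewner`, stub `stub_curveUpgrade` (the ABSTRACT
upgrade "range convergence + endpoints + no triple strands ⟹ curve convergence"). This part is pure
real analysis (namespace `…RootLocality.Upgrade`):

* `exists_upcrossing` / `exists_downcrossing` — a continuous `ψ` with `ψ a ≤ L₁ < L₂ ≤ ψ b` has a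
  sub-interval `[a', b'] ⊆ [a, b]` mapped exactly onto `[L₁, L₂]`, entered at level `L₁` and left
  at level `L₂` (resp. the mirror statement);
* `exists_three_crossings` (registered helper) — if moreover `ψ` BACKTRACKS (`L₂ < ψ x`, `ψ y < L₁`
  for some `x ≤ y`) between `ψ 0 ≤ L₁` and `L₂ ≤ ψ 1`, there are three parameter intervals
  `[s 0, t 0]`, `[s 1, t 1]`, `[s 2, t 2]` of `[0, 1]`, in order and pairwise disjoint
  (`t 0 < s 1`, `t 1 < s 2`), each mapped by `ψ` exactly onto `[L₁, L₂]`.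

Applied (part 1c) to a continuous approximate projection `ψ` of a curve `c` onto a simple arc `η`,
the three intervals are three parameter-disjoint sub-arcs of `c` each Hausdorff-close to the
sub-arc `η [L₁, L₂]`: an `(ε, ℓ)`-triple strand. Folklore (intermediate value theorem); the level
crossings are the tree's `QuasiGeodesic.exists_first_crossing` / `exists_last_crossing`.
-/

open Set

namespace Summit.CriticalPhenomena.SAWScalingLimit.Theorems.HexConjecture.RootLocality.Upgrade

open Literature.Analysis.Complex.QuasiGeodesic (exists_first_crossing exists_last_crossing)

/-- **Up-crossing.** If `ψ` is continuous, `a ≤ b`, `L₁ < L₂`, `ψ a ≤ L₁` and `L₂ ≤ ψ b`, then some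
`[a', b'] ⊆ [a, b]` has `ψ a' = L₁`, `ψ b' = L₂` and `ψ [a', b'] ⊆ [L₁, L₂]` (take `b'` the first
time `ψ = L₂` and `a'` the last time `ψ = L₁` before it). [folklore] -/
theorem exists_upcrossing {ψ : ℝ → ℝ} (hψ : Continuous ψ) {a b L₁ L₂ : ℝ} (hab : a ≤ b)
    (hL : L₁ < L₂) (ha : ψ a ≤ L₁) (hb : L₂ ≤ ψ b) :
    ∃ a' b', a ≤ a' ∧ a' ≤ b' ∧ b' ≤ b ∧ ψ a' = L₁ ∧ ψ b' = L₂ ∧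
      ∀ x ∈ Icc a' b', ψ x ∈ Icc L₁ L₂ := by
  obtain ⟨b', hb', hψb', hbefore⟩ :=
    exists_first_crossing hab hψ.continuousOn (ha.trans_lt hL) hb
  have hneg : ContinuousOn (fun x ↦ -ψ x) (Icc a b') := hψ.neg.continuousOn
  obtain ⟨a', ha', hψa', hafter⟩ :=
    exists_last_crossing (ψ := fun x ↦ -ψ x) (d := -L₁) hb'.1.le hneg (by simpa using ha)
      (by simp [hψb', hL])
  refine ⟨a', b', ha'.1, ha'.2.le, hb'.2, by simpa using hψa', hψb', fun x hx ↦ ⟨?_, ?_⟩⟩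
  · rcases hx.1.eq_or_lt with rfl | hlt
    · exact le_of_eq (by simpa using hψa'.symm)
    · have := hafter x ⟨hlt, hx.2⟩
      simp only [neg_lt_neg_iff] at this
      exact this.le
  · rcases hx.2.eq_or_lt with rfl | hlt
    · exact hψb'.le
    · exact (hbefore x ⟨ha'.1.trans hx.1, hlt⟩).le

/-- **Down-crossing**: the mirror image of `exists_upcrossing` (`L₂ ≤ ψ a`, `ψ b ≤ L₁`): some
`[a', b'] ⊆ [a, b]` has `ψ a' = L₂`, `ψ b' = L₁`, `ψ [a', b'] ⊆ [L₁, L₂]`. [folklore] -/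
theorem exists_downcrossing {ψ : ℝ → ℝ} (hψ : Continuous ψ) {a b L₁ L₂ : ℝ} (hab : a ≤ b)
    (hL : L₁ < L₂) (ha : L₂ ≤ ψ a) (hb : ψ b ≤ L₁) :
    ∃ a' b', a ≤ a' ∧ a' ≤ b' ∧ b' ≤ b ∧ ψ a' = L₂ ∧ ψ b' = L₁ ∧
      ∀ x ∈ Icc a' b', ψ x ∈ Icc L₁ L₂ := by
  obtain ⟨a', b', h1, h2, h3, h4, h5, h6⟩ :=
    exists_upcrossing (ψ := fun x ↦ -ψ x) hψ.neg hab (neg_lt_neg hL) (by simpa using ha)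
      (by simpa using hb)
  refine ⟨a', b', h1, h2, h3, by simpa using h4, by simpa using h5, fun x hx ↦ ?_⟩
  have := h6 x hx
  simp only [mem_Icc, neg_le_neg_iff] at this
  exact ⟨this.2, this.1⟩

/-- The image of a crossing interval is exactly `[L₁, L₂]` (intermediate value theorem). [folklore] -/
theorem image_Icc_eq_of_crossing {ψ : ℝ → ℝ} (hψ : Continuous ψ) {a' b' L₁ L₂ : ℝ} (hab : a' ≤ b')
    (hends : (ψ a' = L₁ ∧ ψ b' = L₂) ∨ (ψ a' = L₂ ∧ ψ b' = L₁))
    (hin : ∀ x ∈ Icc a' b', ψ x ∈ Icc L₁ L₂) : ψ '' Icc a' b' = Icc L₁ L₂ := by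
  refine Subset.antisymm ?_ ?_
  · rintro _ ⟨x, hx, rfl⟩
    exact hin x hx
  · rcases hends with ⟨h1, h2⟩ | ⟨h1, h2⟩
    · simpa [h1, h2] using intermediate_value_Icc hab hψ.continuousOn
    · simpa [h1, h2] using intermediate_value_Icc' hab hψ.continuousOn

/-- **Three crossings from a backtrack** (registered helper of `stub_curveUpgrade`). Let `ψ : ℝ → ℝ`
be continuous with `ψ 0 ≤ L₁ < L₂ ≤ ψ 1`, and suppose `ψ` backtracks across `[L₁, L₂]`: `L₂ < ψ x`
and `ψ y < L₁` for some `0 ≤ x ≤ y ≤ 1`. Then there are three closed parameter intervals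
`[s i, t i] ⊆ [0, 1]`, in order and pairwise disjoint (`t 0 < s 1`, `t 1 < s 2`), each mapped by
`ψ` exactly onto `[L₁, L₂]`: an up-crossing before `x`, a down-crossing between `x` and `y`, an
up-crossing after `y`; consecutive ones are disjoint because they end/start at different levels
than `ψ x`, `ψ y`. [folklore] -/
theorem exists_three_crossings : ∀ (ψ : ℝ → ℝ) (L₁ L₂ x y : ℝ), Continuous ψ → L₁ < L₂ → ψ 0 ≤ L₁ → L₂ ≤ ψ 1 → 0 ≤ x → x ≤ y → y ≤ 1 → L₂ < ψ x → ψ y < L₁ → ∃ s t : Fin 3 → ℝ, (∀ i, 0 ≤ s i ∧ s i ≤ t i ∧ t i ≤ 1) ∧ t 0 < s 1 ∧ t 1 < s 2 ∧ ∀ i, ψ '' Set.Icc (s i) (t i) = Set.Icc L₁ L₂ := by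
  intro ψ L₁ L₂ x y hψ hL h0 h1 hx hxy hy hψx hψy
  -- pass 1: up-crossing on `[0, x]`
  obtain ⟨a₁, b₁, ha₁, hab₁, hb₁, hψa₁, hψb₁, hin₁⟩ := exists_upcrossing hψ hx hL h0 hψx.le
  -- pass 2: down-crossing on `[x, y]`
  obtain ⟨a₂, b₂, ha₂, hab₂, hb₂, hψa₂, hψb₂, hin₂⟩ := exists_downcrossing hψ hxy hL hψx.le hψy.le
  -- pass 3: up-crossing on `[y, 1]`
  obtain ⟨a₃, b₃, ha₃, hab₃, hb₃, hψa₃, hψb₃, hin₃⟩ := exists_upcrossing hψ hy hL hψy.le h1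
  -- disjointness
  have h12 : b₁ < a₂ := by
    refine lt_of_le_of_ne (hb₁.trans ha₂) ?_
    rintro rfl
    have : b₁ = x := le_antisymm hb₁ ha₂
    rw [this] at hψb₁
    exact absurd hψb₁ (ne_of_gt hψx)
  have h23 : b₂ < a₃ := by
    refine lt_of_le_of_ne (hb₂.trans ha₃) ?_
    rintro rfl
    have : b₂ = y := le_antisymm hb₂ ha₃
    rw [this] at hψb₂
    exact absurd hψb₂ (ne_of_lt hψy)
  refine ⟨![a₁, a₂, a₃], ![b₁, b₂, b₃], ?_, by simpa using h12, by simpa using h23, ?_⟩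
  · intro i
    fin_cases i
    · exact ⟨ha₁, hab₁, hb₁.trans (hxy.trans hy)⟩
    · exact ⟨hx.trans ha₂, hab₂, hb₂.trans hy⟩
    · exact ⟨(hx.trans hxy).trans ha₃, hab₃, hb₃⟩
  · intro i
    fin_cases i
    · exact image_Icc_eq_of_crossing hψ hab₁ (Or.inl ⟨hψa₁, hψb₁⟩) hin₁
    · exact image_Icc_eq_of_crossing hψ hab₂ (Or.inr ⟨hψa₂, hψb₂⟩) hin₂
    · exact image_Icc_eq_of_crossing hψ hab₃ (Or.inl ⟨hψa₃, hψb₃⟩) hin₃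

end Summit.CriticalPhenomena.SAWScalingLimit.Theorems.HexConjecture.RootLocality.Upgrade
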